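import Literature.Analysis.FluidPDE.DivPotentialHeatPairing
import Literature.Analysis.UnboundedOperators.HeatFlowCalculus
import HarnessLib

/-!
# The heat flow of the Leray gradient part as a time integral of heat flows of the source

Analysis/FluidPDE support file (theorems only) for `ClassicalLerayProjection.lean`
(`divPotential G = π[G] = Γ ⋆ div G`, `classicalLerayProj G = G - ∇π[G]`), written for the
complexification of the forcing term in the proof of the named fact
`Literature.Analysis.FluidPDE.bradshawGrujicKukavica2015_local_analyticity_radius`. For a test
field `G ∈ C_c^∞(ℝ³; ℝ³)`, `τ > 0` and every `x`:

* `heatExtension_divPotential_eq_neg_integral_Ioi` —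
  `e^{τΔ}π[G](x) = -∫_τ^∞ e^{sΔ}(div G)(x) ds`: `s ↦ e^{sΔ}π(x)` has derivative
  `e^{sΔ}(Δπ)(x) = e^{sΔ}(div G)(x)` (`π ∈ C_b²`, the heat equation for bounded `C²` data), is
  integrated on `[τ, S]`, and `e^{SΔ}π(x) → 0` as `S → ∞` because `π ∈ L²`; the right-hand side
  converges absolutely since `|e^{sΔ}g(x)| ≤ (4πs)^{-3/2}‖g‖₁`;
* `fderiv_divPotential_apply_eq_divPotential_smul` — `∂ₐπ[G] = π[(div G) a]` (the derivative falls
  on the source, and `∂ₐ g = div (g a)`), whence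
  `heatExtension_fderiv_divPotential_eq_neg_integral_Ioi` —
  `e^{τΔ}(∂ₐπ[G])(x) = -∫_τ^∞ e^{sΔ}(∂ₐ div G)(x) ds`;
* `heatExtension_classicalLerayProj_apply_inner` — the componentwise **heat-flow form of the Leray
  projection of a test field**:
  `⟪e^{τΔ}P[G](x), a⟫ = ⟪e^{τΔ}G(x), a⟫ + ∫_τ^∞ e^{sΔ}(∂ₐ div G)(x) ds`
  (Lemarié-Rieusset 2016, §6.2: `P = Id - ∇Δ⁻¹div` with `Δ⁻¹e^{τΔ} = -∫_τ^∞ e^{sΔ} ds`).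

Only heat flows of the compactly supported sources `div G`, `∂ₐ div G` appear on the right, which
is what makes the complexification in `x` away from the support of `G` elementary.

## References

* P. G. Lemarié-Rieusset, *The Navier–Stokes Problem in the 21st Century*, CRC Press 2016, §6.2
  (the Oseen tensor `e^{τΔ}P` through the heat kernel). [LemarieRieusset2016]
* D. Gilbarg, N. S. Trudinger, *Elliptic PDE of Second Order* (2001), Lemma 4.1–4.2.
  [GilbargTrudinger2001]
-/

noncomputable section

open MeasureTheory Set Function Filter Metric Real
open _root_.Topology
open scoped ENNReal ContDiff Laplacian InnerProductSpace RealInnerProductSpace Convolution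

namespace Literature.Analysis.FluidPDE

variable {G : EuclideanSpace ℝ (Fin 3) → EuclideanSpace ℝ (Fin 3)}

/-! ### `∂ₐπ[G] = π[(div G) a]` and `C_b²` bounds for `π[G]` -/

/-- `div (g a) = ∂ₐ g` for a scalar `g` and a constant vector `a` (private copy, in the form used
here, of the tree's `divergence_smul_const` of `SpaceTimeMollifier.lean`, not imported). [folklore] -/
private theorem divergence_smul_const' {g : EuclideanSpace ℝ (Fin 3) → ℝ} (hg : Differentiable ℝ g)
    (a x : EuclideanSpace ℝ (Fin 3)) :
    VectorCalculus.divergence (fun y => g y • a) x = fderiv ℝ g x a := by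
  set b := EuclideanSpace.basisFun (Fin 3) ℝ with hb
  rw [divergence_eq_sum_inner_fderiv b, fderiv_smul_const (hg x) a]
  simp only [ContinuousLinearMap.smulRight_apply, inner_smul_right]
  have e : fderiv ℝ g x a = ∑ i, ⟪b i, a⟫ * fderiv ℝ g x (b i) := by
    conv_lhs => rw [← b.sum_repr' a]
    simp [map_sum, map_smul]
  rw [e]
  exact Finset.sum_congr rfl fun i _ => by ring

/-- **`∂ₐπ[G](y) = π[(div G) a](y)`**: the derivative of the potential of the divergence in the
direction `a` is the potential of the divergence of the field `(div G) a`. [cite: GilbargTrudinger2001, Lemma 4.1] -/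
theorem fderiv_divPotential_apply_eq_divPotential_smul (hG : ContDiff ℝ ∞ G) (hGc : HasCompactSupport G)
    (y a : EuclideanSpace ℝ (Fin 3)) :
    fderiv ℝ (divPotential G) y a =
      divPotential (fun x => (VectorCalculus.divergence G x) • a) y := by
  have hg : ContDiff ℝ ∞ (VectorCalculus.divergence G) := contDiff_divergence_of_contDiff_top hG
  have hgc : HasCompactSupport (VectorCalculus.divergence G) :=
    hGc.mono' fun x hx => by
      by_contra h; exact hx (divergence_eq_zero_of_notMem_tsupport h)
  rw [show divPotential G = fun y => ∫ x, newtonKernel (y - x) * VectorCalculus.divergence G x from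
      funext fun y => divPotential_apply G y,
    fderiv_integral_newtonKernel_mul_apply (by exact_mod_cast hg) hgc y a, divPotential_apply]
  refine integral_congr_ae (Eventually.of_forall fun x => ?_)
  show newtonKernel (y - x) * fderiv ℝ (VectorCalculus.divergence G) x a =
    newtonKernel (y - x) * VectorCalculus.divergence (fun z => VectorCalculus.divergence G z • a) x
  rw [divergence_smul_const' (hg.differentiable (by norm_cast)) a x]

/-- The field `(div G) a` is a test field. [folklore] -/
theorem contDiff_divergence_smul_const (hG : ContDiff ℝ ∞ G) (a : EuclideanSpace ℝ (Fin 3)) :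
    ContDiff ℝ ∞ fun x => (VectorCalculus.divergence G x) • a :=
  (contDiff_divergence_of_contDiff_top hG).smul contDiff_const

/-- The field `(div G) a` has compact support. [folklore] -/
theorem hasCompactSupport_divergence_smul_const (hGc : HasCompactSupport G) (a : EuclideanSpace ℝ (Fin 3)) :
    HasCompactSupport fun x => (VectorCalculus.divergence G x) • a :=
  hGc.mono' fun x hx => by
    by_contra h
    exact hx (by simp [divergence_eq_zero_of_notMem_tsupport h])

/-- An operator norm is at most the sum of the norms of the images of an orthonormal basis.
[folklore] -/
theorem opNorm_le_sum_norm_apply_basisFun {F : Type*} [NormedAddCommGroup F] [NormedSpace ℝ F]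
    (A : EuclideanSpace ℝ (Fin 3) →L[ℝ] F) :
    ‖A‖ ≤ ∑ i, ‖A (EuclideanSpace.basisFun (Fin 3) ℝ i)‖ := by
  set b := EuclideanSpace.basisFun (Fin 3) ℝ with hb
  refine ContinuousLinearMap.opNorm_le_bound _ (Finset.sum_nonneg fun i _ => norm_nonneg _) fun v => ?_
  have hv : A v = ∑ i, ⟪b i, v⟫ • A (b i) := by
    conv_lhs => rw [← b.sum_repr' v]
    simp [map_sum, map_smul]
  rw [hv, Finset.sum_mul]
  refine (norm_sum_le _ _).trans (Finset.sum_le_sum fun i _ => ?_)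
  rw [norm_smul, mul_comm]
  refine mul_le_mul_of_nonneg_left ?_ (norm_nonneg _)
  calc ‖⟪b i, v⟫‖ ≤ ‖b i‖ * ‖v‖ := norm_inner_le_norm _ _
    _ = ‖v‖ := by rw [b.orthonormal.1 i, one_mul]

/-- **`π[G] ∈ C_b²`**: bounds for `π[G]`, `Dπ[G]` and `D²π[G]`. [folklore] -/
theorem exists_divPotential_C2_bounds (hG : ContDiff ℝ ∞ G) (hGc : HasCompactSupport G) :
    ∃ C₀ C₁ C₂ : ℝ, (∀ z, ‖divPotential G z‖ ≤ C₀) ∧ (∀ z, ‖fderiv ℝ (divPotential G) z‖ ≤ C₁) ∧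
      ∀ z, ‖fderiv ℝ (fderiv ℝ (divPotential G)) z‖ ≤ C₂ := by
  obtain ⟨C₀, hC₀⟩ := exists_forall_abs_divPotential_le hG hGc
  obtain ⟨C₁, hC₁⟩ := exists_forall_norm_gradient_divPotential_le hG hGc
  set b := EuclideanSpace.basisFun (Fin 3) ℝ with hb
  have hπ : ContDiff ℝ ∞ (divPotential G) := contDiff_divPotential hG hGc
  -- second derivatives through the components `∂ᵢπ = π[(div G) bᵢ]`
  have hcomp : ∀ i, ∃ D : ℝ, ∀ z, ‖fderiv ℝ (fun y => fderiv ℝ (divPotential G) y (b i)) z‖ ≤ D := by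
    intro i
    obtain ⟨D, hD⟩ := exists_forall_norm_gradient_divPotential_le (contDiff_divergence_smul_const hG (b i))
      (hasCompactSupport_divergence_smul_const hGc (b i))
    refine ⟨D, fun z => ?_⟩
    rw [show (fun y => fderiv ℝ (divPotential G) y (b i)) =
      divPotential (fun x => (VectorCalculus.divergence G x) • b i) from
      funext fun y => fderiv_divPotential_apply_eq_divPotential_smul hG hGc y (b i)]
    have := hD z
    rwa [gradient, LinearIsometryEquiv.norm_map] at this
  choose D hD using hcomp
  refine ⟨C₀, C₁, ∑ i, D i, fun z => (Real.norm_eq_abs _).le.trans (hC₀ z), fun z => ?_, fun z => ?_⟩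
  · have := hC₁ z
    rwa [gradient, LinearIsometryEquiv.norm_map] at this
  · have hflip : ‖fderiv ℝ (fderiv ℝ (divPotential G)) z‖ =
        ‖(fderiv ℝ (fderiv ℝ (divPotential G)) z).flip‖ := (ContinuousLinearMap.opNorm_flip _).symm
    rw [hflip]
    refine (opNorm_le_sum_norm_apply_basisFun _).trans (Finset.sum_le_sum fun i _ => ?_)
    have hd : DifferentiableAt ℝ (fderiv ℝ (divPotential G)) z :=
      ((hπ.fderiv_right (m := 1) (by norm_cast)).differentiable one_ne_zero) z
    have e : (fderiv ℝ (fderiv ℝ (divPotential G)) z).flip (b i) =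
        fderiv ℝ (fun y => fderiv ℝ (divPotential G) y (b i)) z := by
      rw [fderiv_clm_apply hd (differentiableAt_const _)]
      simp
    rw [e]
    exact hD i z

/-! ### The heat flow of `π[G]` as a time integral -/

/-- **Heat-kernel smoothing of a test function**: `|e^{sΔ}g(x)| ≤ (4πs)^{-3/2} ‖g‖₁`. [folklore] -/
theorem norm_heatExtension_le_rpow_mul_integral_norm {F : Type*} [NormedAddCommGroup F]
    [NormedSpace ℝ F] {g : EuclideanSpace ℝ (Fin 3) → F} (hg : Continuous g)
    (hgc : HasCompactSupport g) {s : ℝ} (hs : 0 < s) (x : EuclideanSpace ℝ (Fin 3)) :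
    ‖UnboundedOperators.heatExtension g s x‖ ≤ (4 * Real.pi * s) ^ (-(3 : ℝ) / 2) * ∫ y, ‖g y‖ := by
  have hgi : Integrable (fun y => ‖g (x - y)‖) :=
    ((hg.integrable_of_hasCompactSupport hgc).comp_sub_left x).norm
  rw [UnboundedOperators.heatExtension_apply, ← integral_sub_left_eq_self (fun y => ‖g y‖) volume x,
    ← integral_const_mul]
  refine (norm_integral_le_integral_norm _).trans (integral_mono_of_nonneg
    (Eventually.of_forall fun y => norm_nonneg _) (hgi.const_mul _) (Eventually.of_forall fun y => ?_))
  show ‖UnboundedOperators.heatKernel s y • g (x - y)‖ ≤ (4 * Real.pi * s) ^ (-(3 : ℝ) / 2) * ‖g (x - y)‖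
  rw [norm_smul, Real.norm_of_nonneg (UnboundedOperators.heatKernel_pos hs y).le]
  refine mul_le_mul_of_nonneg_right ?_ (norm_nonneg _)
  have h := UnboundedOperators.heatKernel_le hs y
  rwa [finrank_euclideanSpace_fin, show (-((3 : ℕ) : ℝ)) / 2 = -(3 : ℝ) / 2 by norm_num] at h

/-- The heat flows of a test function at a point are integrable in time on `(τ, ∞)`, `τ > 0`.
[folklore] -/
theorem integrableOn_Ioi_heatExtension {F : Type*} [NormedAddCommGroup F] [NormedSpace ℝ F]
    [CompleteSpace F] {g : EuclideanSpace ℝ (Fin 3) → F} (hg : Continuous g) (hgc : HasCompactSupport g)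
    {τ : ℝ} (hτ : 0 < τ) (x : EuclideanSpace ℝ (Fin 3)) :
    IntegrableOn (fun s => UnboundedOperators.heatExtension g s x) (Ioi τ) := by
  obtain ⟨C, hC⟩ := hg.norm.bddAbove_range_of_hasCompactSupport hgc.norm
  have hmem : MemLp g ∞ (volume : Measure (EuclideanSpace ℝ (Fin 3))) :=
    memLp_top_of_bound hg.aestronglyMeasurable C (Eventually.of_forall fun z => hC (mem_range_self z))
  have hcont : ContinuousOn (fun s => UnboundedOperators.heatExtension g s x) (Ioi τ) :=
    (UnboundedOperators.continuousOn_heatExtension_time hmem le_top x).mono (Ioi_subset_Ioi hτ.le)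
  have hr : (-(3 : ℝ) / 2) < -1 := by norm_num
  have hdom : IntegrableOn (fun s : ℝ => (4 * Real.pi) ^ (-(3 : ℝ) / 2) * s ^ (-(3 : ℝ) / 2) * ∫ y, ‖g y‖)
      (Ioi τ) :=
    (((integrableOn_Ioi_rpow_of_lt hr hτ).const_mul _).mul_const _)
  refine hdom.mono' (hcont.aestronglyMeasurable measurableSet_Ioi) ?_
  refine (ae_restrict_iff' measurableSet_Ioi).2 (Eventually.of_forall fun s hs => ?_)
  have hs0 : 0 < s := hτ.trans hs
  refine (norm_heatExtension_le_rpow_mul_integral_norm hg hgc hs0 x).trans_eq ?_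
  rw [Real.mul_rpow (by positivity) hs0.le]

/-- **The heat flow of the potential of the divergence is a time integral**:
`e^{τΔ}π[G](x) = -∫_τ^∞ e^{sΔ}(div G)(x) ds` for `τ > 0`. [cite: LemarieRieusset2016, §6.2] -/
theorem heatExtension_divPotential_eq_neg_integral_Ioi (hG : ContDiff ℝ ∞ G) (hGc : HasCompactSupport G)
    {τ : ℝ} (hτ : 0 < τ) (x : EuclideanSpace ℝ (Fin 3)) :
    UnboundedOperators.heatExtension (divPotential G) τ x =
      -∫ s in Ioi τ, UnboundedOperators.heatExtension (VectorCalculus.divergence G) s x := by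
  have hg : ContDiff ℝ ∞ (VectorCalculus.divergence G) := contDiff_divergence_of_contDiff_top hG
  have hgc : HasCompactSupport (VectorCalculus.divergence G) :=
    hGc.mono' fun x hx => by
      by_contra h; exact hx (divergence_eq_zero_of_notMem_tsupport h)
  have hπ : ContDiff ℝ ∞ (divPotential G) := contDiff_divPotential hG hGc
  obtain ⟨C₀, C₁, C₂, h0, h1, h2⟩ := exists_divPotential_C2_bounds hG hGc
  -- the derivative in time
  have hderiv : ∀ s, 0 < s → HasDerivAt (fun σ => UnboundedOperators.heatExtension (divPotential G) σ x)
      (UnboundedOperators.heatExtension (VectorCalculus.divergence G) s x) s := by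
    intro s hs
    have h := UnboundedOperators.hasDerivAt_heatExtension_time_of_bounded (hπ.of_le (by norm_cast))
      h0 h1 h2 hs x
    have e : (Δ (divPotential G)) = VectorCalculus.divergence G := funext (laplacian_divPotential hG hGc)
    rwa [e] at h
  -- FTC on `[τ, S]`
  have hint := integrableOn_Ioi_heatExtension hg.continuous hgc hτ x
  have hFTC : ∀ S, τ ≤ S → ∫ s in τ..S, UnboundedOperators.heatExtension (VectorCalculus.divergence G) s x =
      UnboundedOperators.heatExtension (divPotential G) S x -
        UnboundedOperators.heatExtension (divPotential G) τ x := by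
    intro S hS
    refine intervalIntegral.integral_eq_sub_of_hasDerivAt (fun s hs => hderiv s ?_) ?_
    · rw [uIcc_of_le hS] at hs
      exact hτ.trans_le hs.1
    · exact (intervalIntegrable_iff_integrableOn_Ioc_of_le hS).2 (hint.mono_set Ioc_subset_Ioi_self)
  -- `S → ∞`
  have hπ2 : MemLp (divPotential G) 2 (volume : Measure (EuclideanSpace ℝ (Fin 3))) :=
    ⟨hπ.continuous.aestronglyMeasurable, by
      rw [eLpNorm_lt_top_iff_lintegral_rpow_enorm_lt_top two_ne_zero ENNReal.ofNat_ne_top]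
      simpa using lintegral_enorm_sq_divPotential_lt_top hG hGc⟩
  have hlim0 : Tendsto (fun S : ℝ => UnboundedOperators.heatExtension (divPotential G) S x) atTop (𝓝 0) := by
    have h1 := UnboundedOperators.tendsto_enorm_heatExtension_atTop hπ2 (by norm_num) (by norm_num)
      (Module.finrank_pos (R := ℝ) (M := EuclideanSpace ℝ (Fin 3))) x
    rw [tendsto_zero_iff_norm_tendsto_zero]
    have h2 := (ENNReal.tendsto_toReal ENNReal.zero_ne_top).comp h1
    rw [ENNReal.toReal_zero] at h2
    exact h2.congr fun σ => by simp
  have hlim1 : Tendsto (fun S => ∫ s in τ..S, UnboundedOperators.heatExtension (VectorCalculus.divergence G) s x)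
      atTop (𝓝 (∫ s in Ioi τ, UnboundedOperators.heatExtension (VectorCalculus.divergence G) s x)) :=
    intervalIntegral_tendsto_integral_Ioi τ hint tendsto_id
  have hlim2 : Tendsto (fun S => ∫ s in τ..S, UnboundedOperators.heatExtension (VectorCalculus.divergence G) s x)
      atTop (𝓝 (0 - UnboundedOperators.heatExtension (divPotential G) τ x)) := by
    have heq : (fun S => ∫ s in τ..S, UnboundedOperators.heatExtension (VectorCalculus.divergence G) s x)
        =ᶠ[atTop] fun S => UnboundedOperators.heatExtension (divPotential G) S x -
          UnboundedOperators.heatExtension (divPotential G) τ x := by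
      filter_upwards [eventually_ge_atTop τ] with S hS
      exact hFTC S hS
    rw [tendsto_congr' heq]
    exact hlim0.sub_const _
  rw [tendsto_nhds_unique hlim1 hlim2, zero_sub, neg_neg]

/-- **The heat flow of a derivative of the potential**:
`e^{τΔ}(∂ₐπ[G])(x) = -∫_τ^∞ e^{sΔ}(∂ₐ div G)(x) ds` for `τ > 0`. [cite: LemarieRieusset2016, §6.2] -/
theorem heatExtension_fderiv_divPotential_eq_neg_integral_Ioi (hG : ContDiff ℝ ∞ G)
    (hGc : HasCompactSupport G) (a : EuclideanSpace ℝ (Fin 3)) {τ : ℝ} (hτ : 0 < τ)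
    (x : EuclideanSpace ℝ (Fin 3)) :
    UnboundedOperators.heatExtension (fun y => fderiv ℝ (divPotential G) y a) τ x =
      -∫ s in Ioi τ, UnboundedOperators.heatExtension
        (fun y => fderiv ℝ (VectorCalculus.divergence G) y a) s x := by
  have hg : ContDiff ℝ ∞ (VectorCalculus.divergence G) := contDiff_divergence_of_contDiff_top hG
  rw [show (fun y => fderiv ℝ (divPotential G) y a) =
      divPotential (fun x => (VectorCalculus.divergence G x) • a) from
      funext fun y => fderiv_divPotential_apply_eq_divPotential_smul hG hGc y a,
    heatExtension_divPotential_eq_neg_integral_Ioi (contDiff_divergence_smul_const hG a)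
      (hasCompactSupport_divergence_smul_const hGc a) hτ x]
  congr 1
  refine setIntegral_congr_fun measurableSet_Ioi fun s _ => ?_
  congr 1
  funext y
  exact divergence_smul_const' (hg.differentiable (by norm_cast)) a y

/-- **Heat-flow form of the Leray projection of a test field, componentwise**:
`⟪e^{τΔ}P[G](x), a⟫ = ⟪e^{τΔ}G(x), a⟫ + ∫_τ^∞ e^{sΔ}(∂ₐ div G)(x) ds` for `τ > 0`
(`P[G] = G - ∇π[G]`, `⟪∇π, a⟫ = ∂ₐπ`, linearity of `e^{τΔ}` on bounded continuous data).
[cite: LemarieRieusset2016, §6.2] -/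
theorem inner_heatExtension_classicalLerayProj (hG : ContDiff ℝ ∞ G) (hGc : HasCompactSupport G)
    {τ : ℝ} (hτ : 0 < τ) (x a : EuclideanSpace ℝ (Fin 3)) :
    ⟪UnboundedOperators.heatExtension (classicalLerayProj G) τ x, a⟫ =
      ⟪UnboundedOperators.heatExtension G τ x, a⟫ +
        ∫ s in Ioi τ, UnboundedOperators.heatExtension
          (fun y => fderiv ℝ (VectorCalculus.divergence G) y a) s x := by
  have hπ1 : ContDiff ℝ 1 (divPotential G) := (contDiff_divPotential hG hGc).of_le (by norm_cast)
  have hgrad : Continuous (gradient (divPotential G)) := continuous_gradient_of_contDiff hπ1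
  obtain ⟨CG, hCG⟩ := hG.continuous.norm.bddAbove_range_of_hasCompactSupport hGc.norm
  obtain ⟨Cg, hCg⟩ := exists_forall_norm_gradient_divPotential_le hG hGc
  -- `e^{τΔ}(G - ∇π) = e^{τΔ}G - e^{τΔ}∇π`
  rw [show classicalLerayProj G = fun z => G z - gradient (divPotential G) z from rfl,
    UnboundedOperators.heatExtension_sub_of_bound hG.continuous hgrad (fun z => hCG (mem_range_self z)) hCg
      hτ x, inner_sub_left]
  -- `⟪e^{τΔ}∇π(x), a⟫ = e^{τΔ}(∂ₐπ)(x)`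
  have hclm : ⟪UnboundedOperators.heatExtension (gradient (divPotential G)) τ x, a⟫ =
      UnboundedOperators.heatExtension (fun y => fderiv ℝ (divPotential G) y a) τ x := by
    rw [real_inner_comm, ← innerSL_apply_apply (𝕜 := ℝ),
      ← UnboundedOperators.heatExtension_clm_comp_of_bound (innerSL ℝ a) hgrad hCg hτ x]
    congr 1
    funext z
    show ⟪a, gradient (divPotential G) z⟫ = fderiv ℝ (divPotential G) z a
    rw [real_inner_comm, gradient, InnerProductSpace.toDual_symm_apply]
  rw [hclm, heatExtension_fderiv_divPotential_eq_neg_integral_Ioi hG hGc a hτ x, sub_neg_eq_add]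

end Literature.Analysis.FluidPDE
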